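import Summits.BirchSwinnertonDyer.Rank1Residual.Additive.RamifiedSevenGenusDiscriminantSign
import Literature.NumberTheory.EllipticCurves.DeuringGrossencharacterHolds
import Literature.NumberTheory.EllipticCurves.ComplexMultiplicationLFunctionIsogenyHoldsProofs
import Literature.NumberTheory.EllipticCurves.LFunctionSmulProofs
import Literature.FieldTheory.Galois.SolvableCompositum
import HarnessLib

/-!
# The Grössencharacter column of a `𝒞₇`-member: `ψ` of type `(1,0)` with `L(ψ, s) = L(W, s)` — a THEOREM
# (and the complex-embedding column `ιC`)

Crux `stmt-BirchSwinnertonDyer-19945` (K7r, `Cruxes/EllipticUnitValueSevenOfGZK/Lines/kato_perrin_riou_zp.lean`),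
row K2C-4 of cell `bsd-cm`, block (X-c) (the existence ledger of `GenusSeven.PinnedKatoGenusFrame`), FIRST PARTIAL
LEDGER: the fields `ψ`, `ψ_infinityType`, `ψ_LSeries` of `PinnedKatoGenusFrame` (file
`RamifiedSevenGenusKatoPinnedFrame.lean`, the (λ1) block) are INHABITED for every elliptic `W/ℚ` with CM field `ℚ(√−7)`
(`cmFieldDiscrOfJ W.j = −7`, in particular every `W ∈ 𝒞₇`) over ANY quadratic number field `Kcm` containing a square root
of `−7` — hypothesis-free, because Deuring's theorem for the nine maximal-order CM `j`-invariants is a THEOREM of the tree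
(`Deuring_exists_heckeCharacter_of_maximalCM_holds`, `DeuringGrossencharacterHolds.lean`: explicit Größencharaktere, Euler
products prime by prime; no modularity, no main theorem of CM).

## The argument

* `d_K = −7 ⟹ W ~ W₂` over `ℚ` with `W₂` GLOBALLY MINIMAL and `j(W₂) = −3375` (`exists_isIsogenous_isGloballyMinimal_j_eq`):
  the (X-b) representative `W ~ W₁ ≅ cm7^{(d)}` (`DiscriminantSign.exists_isIsogenous_smul_eq_cm7_quadraticTwist'`), the
  `j`-invariant of a twist / of an isomorphic model (`j_quadraticTwist`, `variableChange_j`), and a global minimal model of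
  `W₁` (`hasGlobalMinimalModel_rat_holds`; Néron, Silverman VIII.8.3).
* `Kcm` quadratic with `s² = −7` IS a CM field of `j = −3375` (`IsCMFieldOfJ Kcm (−3375)`: `cmFieldDiscr (−3375) = −7`); it is
  Galois over `ℚ` with a non-trivial automorphism `c` (degree `2`).
* Deuring at `W₂` over `Kcm` and `c`: `ψ` of type `(1,0)`, `c`-equivariant, unramified exactly at the good places of `W₂/K`,
  with `L(ψ, s) = L(W₂, s)` on `re s > 3/2` (`exists_deuringCharacter_member`); and `L(W₂, s) = L(W, s)` by isogeny
  invariance (`IsIsogenous.LSeries_eq`, Faltings) — `exists_grossencharacter`, `exists_grossencharacter_of_classCSeven`.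

* §3 (λ4): the complex-embedding column `ιC`, `ιC_infinitePlace` for any quadratic `Kcm ∋ √−7` — `Kcm` is totally complex with
  ONE infinite place, and the complex embedding lifts to `K̄ →+* ℂ` (`IsAlgClosed.lift`): `exists_ιC`.  Hypothesis-free.

What this does NOT give (NAMED for the (X-c) ledger, not typed here): the conductor pin `ψ_conductor` («`ψ((α)) = ι(α)` for
`α ≡ 1 mod 7|D|`», i.e. `cond ψ ∣ 𝔭·(D)`; print: Gross LNM 776 (8.2.7) `N(A) = 𝔣_A²` with `N(49a1^{(D)}) = 7²D²` — the tree
has the local-exponent fact `Gross_conductorExponent_baseChange_eq_two_mul` but no bridge from `HasConductorExponentAt` to the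
ideal-value congruence), the CM isogeny `φ` with `φ_sq`, the period `Ω` and the value data `𝔏`, `euK`.

HONEST LABEL: theorems; nothing of the K2c input-form stub is discharged by this file beyond the (λ1)/(λ4) fields named;
crux 19945 stays OPEN; `X12.CMRamifiedSeven` is NOT proved; no summit statement is proved.  No `def`, no instance, no
notation, no new fact (D-0026).

## References

[cite: SilvermanATAEC1994, Ch. II Thm. 9.2 (pp. 164–165), Thm. 10.5 (b) (pp. 171–172), App. A §3 (row D = −7)]
[cite: Gross1980, §8.2 (8.2.2)–(8.2.7)] [cite: Faltings1983Endlichkeit, §5 Korollar 2 (isogenous curves have equal L-series)]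
[cite: SilvermanAEC2009, X.5 Cor. 5.4.1, VIII.8 Cor. 8.3]
-/

set_option autoImplicit false

noncomputable section

open scoped Classical

open scoped NumberField

open WeierstrassCurve NumberField IsDedekindDomain Literature.NumberTheory.GaloisRepresentations
  Literature.NumberTheory.EllipticCurves Literature.NumberTheory.EllipticCurves.Rank1Residual

namespace Summit.BirchSwinnertonDyer.Rank1Residual.Additive.GenusSeven.MemberGrossencharacter

/-! ## §1 A globally minimal isogenous member with `j = −3375` -/

/-- **`d_K = −7 ⟹ W ~ W₂`, `W₂` globally minimal, `j(W₂) = −3375 = j(49a1)`** (the (X-b) twist representative, read through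
`j`, then a global minimal model). [cite: SilvermanAEC2009, X.5 Cor. 5.4.1 and VIII.8 Cor. 8.3]
[cite: SilvermanATAEC1994, App. A §3 (row D = −7)] -/
theorem exists_isIsogenous_isGloballyMinimal_j_eq {W : WeierstrassCurve ℚ} [W.IsElliptic]
    (hj : cmFieldDiscrOfJ W.j = -7) :
    ∃ (W₂ : WeierstrassCurve ℚ) (_ : W₂.IsElliptic) (_ : W₂.IsGloballyMinimal), IsIsogenous W W₂ ∧ W₂.j = -3375 := by
  obtain ⟨W₁, hW₁, d, C, hsq, hiso, hC⟩ := DiscriminantSign.exists_isIsogenous_smul_eq_cm7_quadraticTwist' hj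
  haveI := hW₁
  have hd0 : (d : ℚ) ≠ 0 := by exact_mod_cast hsq.ne_zero
  haveI := cm7.isElliptic_quadraticTwist hd0
  have h1 : (C • W₁).j = (cm7.quadraticTwist (d : ℚ)).j := by simp only [hC]
  have hjW₁ : W₁.j = -3375 := by
    rw [← variableChange_j W₁ C, h1, cm7.j_quadraticTwist hd0, j_cm7]
  obtain ⟨C₀, hmin⟩ := hasGlobalMinimalModel_rat_holds W₁
  exact ⟨C₀ • W₁, inferInstance, hmin, hiso.trans' (isIsogenous_smul W₁ C₀), by rw [variableChange_j, hjW₁]⟩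

/-! ## §2 Deuring's Grössencharacter at the member, over any model of `ℚ(√−7)` -/

/-- A quadratic number field containing `√−7` is a CM field of `j = −3375` in the tree's sense `IsCMFieldOfJ`
(`cmFieldDiscr (−3375) = −7`). [cite: SilvermanATAEC1994, App. A §3 (first table, row D = −7)] -/
theorem isCMFieldOfJ_neg3375 (Kcm : Type) [Field Kcm] [NumberField Kcm] (h2 : Module.finrank ℚ Kcm = 2)
    (s : Kcm) (hs : s ^ 2 = -7) : IsCMFieldOfJ Kcm (-3375) := by
  refine ⟨h2, s, ?_⟩
  rw [hs]
  norm_num [cmFieldDiscr]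

/-- A quadratic number field has a non-trivial `ℚ`-automorphism (it is Galois of degree `2`).
[cite: Lang1990, Ch. 13 §4 (cyclic extensions)] -/
theorem exists_algEquiv_ne_one (Kcm : Type) [Field Kcm] [NumberField Kcm] (h2 : Module.finrank ℚ Kcm = 2) :
    ∃ c : Kcm ≃ₐ[ℚ] Kcm, c ≠ 1 := by
  haveI : IsGalois ℚ Kcm := Literature.FieldTheory.Galois.isGalois_of_finrank_eq_two h2
  have hcard : Nat.card (Kcm ≃ₐ[ℚ] Kcm) = 2 := by rw [IsGalois.card_aut_eq_finrank, h2]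
  haveI : Nontrivial (Kcm ≃ₐ[ℚ] Kcm) := Finite.one_lt_card_iff_nontrivial.mp (by omega)
  exact exists_ne 1

/-- **DEURING AT THE MEMBER**: for `W/ℚ` elliptic with `d_K = −7` and any quadratic `Kcm ∋ √−7` with a non-trivial
automorphism `c`, there are a globally minimal `W₂ ~ W` with `j(W₂) = −3375` and a Hecke character `ψ` of `Kcm` of type
`(1,0)`, `c`-equivariant, unramified exactly where `W₂/Kcm` has good reduction, with `L(ψ, s) = L(W₂, s) = L(W, s)` on
`re s > 3/2` — the tree's THEOREM `Deuring_exists_heckeCharacter_of_maximalCM_holds` at `W₂`, and isogeny invariance of `L`.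
[cite: SilvermanATAEC1994, Ch. II Thm. 9.2 (pp. 164–165) and Thm. 10.5 (b) (pp. 171–172)] [cite: Faltings1983Endlichkeit, §5 Korollar 2] -/
theorem exists_deuringCharacter_member {W : WeierstrassCurve ℚ} [W.IsElliptic] (hj : cmFieldDiscrOfJ W.j = -7)
    (Kcm : Type) [Field Kcm] [NumberField Kcm] (h2 : Module.finrank ℚ Kcm = 2) (s : Kcm) (hs : s ^ 2 = -7)
    (c : Kcm ≃ₐ[ℚ] Kcm) (hc : c ≠ 1) :
    ∃ (W₂ : WeierstrassCurve ℚ) (_ : W₂.IsElliptic) (_ : W₂.IsGloballyMinimal) (ψ : HeckeCharacter Kcm),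
      IsIsogenous W W₂ ∧ W₂.j = -3375 ∧
      ψ.HasInfinityType (fun _ ↦ 1) (fun _ ↦ 0) ∧ IsHeckeConjEquivariant c ψ ∧
      (∀ w : HeightOneSpectrum (𝓞 Kcm),
        ψ.IsUnramifiedAt w ↔ (W₂.baseChange Kcm).HasGoodReductionAt w) ∧
      (∀ z : ℂ, 3 / 2 < z.re → heckeLFunction ψ z = W₂.LSeries z) ∧
      ∀ z : ℂ, 3 / 2 < z.re → heckeLFunction ψ z = W.LSeries z := by
  obtain ⟨W₂, hW₂, hmin, hiso, hjW₂⟩ := exists_isIsogenous_isGloballyMinimal_j_eq hj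
  haveI := hW₂
  haveI := hmin
  have hmem : W₂.j ∈ maximalCMJInvariants := by
    rw [hjW₂]
    simp [maximalCMJInvariants]
  have hK : IsCMFieldOfJ Kcm W₂.j := by
    rw [hjW₂]
    exact isCMFieldOfJ_neg3375 Kcm h2 s hs
  obtain ⟨ψ, htype, hconj, hunr, -, hL⟩ := Deuring_exists_heckeCharacter_of_maximalCM_holds W₂ hmem Kcm hK c hc
  have hLW : W₂.LSeries = W.LSeries := (IsIsogenous.LSeries_eq hiso).symm
  exact ⟨W₂, hW₂, hmin, ψ, hiso, hjW₂, htype, hconj, hunr, hL, fun z hz ↦ by rw [hL z hz, hLW]⟩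

/-- **THE (λ1) GRÖSSENCHARACTER COLUMN, hypothesis-free**: for `W/ℚ` elliptic with `cmFieldDiscrOfJ W.j = −7` and any
quadratic `Kcm ∋ √−7` there is `ψ : HeckeCharacter Kcm` with `ψ.HasInfinityType (fun _ ↦ 1) (fun _ ↦ 0)` and
`∀ s, 3/2 < s.re → heckeLFunction ψ s = W.LSeries s` — the `PinnedKatoGenusFrame` fields `ψ`, `ψ_infinityType`, `ψ_LSeries`
token for token. [cite: SilvermanATAEC1994, Ch. II Thm. 9.2 and Thm. 10.5 (b)] [cite: Faltings1983Endlichkeit, §5 Korollar 2] -/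
theorem exists_grossencharacter {W : WeierstrassCurve ℚ} [W.IsElliptic] (hj : cmFieldDiscrOfJ W.j = -7)
    (Kcm : Type) [Field Kcm] [NumberField Kcm] (h2 : Module.finrank ℚ Kcm = 2) (s : Kcm) (hs : s ^ 2 = -7) :
    ∃ ψ : HeckeCharacter Kcm, ψ.HasInfinityType (fun _ ↦ 1) (fun _ ↦ 0) ∧
      ∀ z : ℂ, 3 / 2 < z.re → heckeLFunction ψ z = W.LSeries z := by
  obtain ⟨c, hc⟩ := exists_algEquiv_ne_one Kcm h2
  obtain ⟨-, -, -, ψ, -, -, htype, -, -, -, hL⟩ := exists_deuringCharacter_member hj Kcm h2 s hs c hc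
  exact ⟨ψ, htype, hL⟩

/-- **The (λ1) column on the class `𝒞₇`.** [cite: SilvermanATAEC1994, Ch. II Thm. 9.2 and Thm. 10.5 (b)] -/
theorem exists_grossencharacter_of_classCSeven {W : WeierstrassCurve ℚ} [W.IsElliptic] [W.IsGloballyMinimal]
    (hC : X12.ClassCSeven W) (Kcm : Type) [Field Kcm] [NumberField Kcm] (h2 : Module.finrank ℚ Kcm = 2)
    (s : Kcm) (hs : s ^ 2 = -7) :
    ∃ ψ : HeckeCharacter Kcm, ψ.HasInfinityType (fun _ ↦ 1) (fun _ ↦ 0) ∧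
      ∀ z : ℂ, 3 / 2 < z.re → heckeLFunction ψ z = W.LSeries z :=
  exists_grossencharacter hC.2.1 Kcm h2 s hs

/-! ## §3 (λ4) The complex-embedding column: `ιC : K̄ →+* ℂ` extending the (unique) infinite place -/

/-- A number field containing a square root of `−7` is totally complex. [cite: NeukirchANT1999, Ch. III §1] -/
theorem isTotallyComplex_of_sq_eq_neg_seven (Kcm : Type) [Field Kcm] [NumberField Kcm] (s : Kcm) (hs : s ^ 2 = -7) :
    IsTotallyComplex Kcm := by
  refine ⟨fun v => ?_⟩
  rw [← InfinitePlace.not_isReal_iff_isComplex]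
  intro hv
  have h : (InfinitePlace.embedding_of_isReal hv s) ^ 2 = -7 := by
    rw [← map_pow, hs, map_neg, map_ofNat]
  nlinarith [sq_nonneg (InfinitePlace.embedding_of_isReal hv s)]

/-- An imaginary quadratic field has exactly one infinite place (`r₁ = 0`, `r₁ + 2r₂ = 2`). [cite: NeukirchANT1999, Ch. III §1] -/
theorem subsingleton_infinitePlace (Kcm : Type) [Field Kcm] [NumberField Kcm] (h2 : Module.finrank ℚ Kcm = 2)
    (s : Kcm) (hs : s ^ 2 = -7) : Subsingleton (InfinitePlace Kcm) := by
  haveI := isTotallyComplex_of_sq_eq_neg_seven Kcm s hs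
  have h0 : InfinitePlace.nrRealPlaces Kcm = 0 := (NumberField.nrRealPlaces_eq_zero_iff (K := Kcm)).mpr inferInstance
  have hsum := InfinitePlace.card_add_two_mul_card_eq_rank Kcm
  have hcard : Fintype.card (InfinitePlace Kcm) = 1 := by
    rw [InfinitePlace.card_eq_nrRealPlaces_add_nrComplexPlaces, h0]
    rw [h0, h2] at hsum
    omega
  exact Fintype.card_le_one_iff_subsingleton.mp hcard.le

/-- **THE (λ4) COLUMN `ιC`, `ιC_infinitePlace`, hypothesis-free**: for a quadratic `Kcm ∋ √−7` there is a ring map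
`ιC : AlgebraicClosure Kcm →+* ℂ` with `ιC (algebraMap Kcm K̄ x) = w.embedding x` for EVERY infinite place `w` of `Kcm` (there
is only one) — an algebraically closed lift of the complex embedding (`IsAlgClosed.lift`).  The `PinnedKatoGenusFrame` fields
`ιC`, `ιC_infinitePlace` token for token. [cite: NeukirchANT1999, Ch. III §1] [cite: SilvermanATAEC1994, Ch. II §10 (the embedding fixing the infinity type)] -/
theorem exists_ιC (Kcm : Type) [Field Kcm] [NumberField Kcm] (h2 : Module.finrank ℚ Kcm = 2) (s : Kcm) (hs : s ^ 2 = -7) :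
    ∃ ιC : AlgebraicClosure Kcm →+* ℂ,
      ∀ (w : InfinitePlace Kcm) (x : Kcm), ιC (algebraMap Kcm (AlgebraicClosure Kcm) x) = w.embedding x := by
  haveI := subsingleton_infinitePlace Kcm h2 s hs
  obtain ⟨w₀⟩ : Nonempty (InfinitePlace Kcm) := inferInstance
  letI : Algebra Kcm ℂ := w₀.embedding.toAlgebra
  let ι : AlgebraicClosure Kcm →ₐ[Kcm] ℂ := IsAlgClosed.lift
  refine ⟨ι.toRingHom, fun w x => ?_⟩
  rw [Subsingleton.elim w w₀]
  exact ι.commutes x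

end Summit.BirchSwinnertonDyer.Rank1Residual.Additive.GenusSeven.MemberGrossencharacter

end
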